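import Literature.IUT.LogVolume.Corollary22TateInput
import Literature.IUT.LogVolume.Corollary22QParamBaseChange
import Literature.NumberTheory.DiophantineGeometry.GenEllMellReduction
import Summits.ABC.IUTFork.Cor312ProvenanceS
import HarnessLib

/-!
# [IUTchIII] Cor. 3.12 for the Θ-data of a point of the `λ`-line ⟹ the display of [IUTchIV] Thm. 1.10 for that
# point — the POINT DICTIONARY of the provenance link (c312 crew, wave 2, board row W2-F′)

Record-only file of the abc-iut cell (seat abc-iut-c312-8, gen 2; plan/COR312-ASSIGNMENTS.md row W2-F′); TAKES NO
SIDE on [IUTchIII] Cor. 3.12. The cell's two campaigns meet at ONE printed sentence, [IUTchIV] Cor. 2.2 (ii), proof,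
kurims p. 46: "if one takes … “`F`” to be the number field `F`, “`X_F`” to be the once-punctured elliptic curve
associated to `E_F` [the Legendre curve `y² = x(x−1)(x−λ)` of the point `x_E = λ`, p. 42], “`l`” to be the prime
number `l`, and “`𝕍^bad_mod`” to be the set `𝕍^bad_mod` of (P5) [“the nonarchimedean valuations … that do not divide
`2l` and at which `E_F` has bad multiplicative reduction”], then … (P7) … we may apply Theorem 1.10 to conclude
that `(1/6)·log(q) ≤ (1 + 20·d_mod/l)·(log(𝔡^{F_tpd}) + log(𝔣^{F_tpd})) + 20·(d*_mod·l + η_prm)`".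

* Campaign S (abc-iut-S-d2, `Corollary22Legendre.lean`) typed the CONCLUSION of that sentence for a point `P` of
  the `λ`-line (the tree's `NFPoint`) as `Cor22.Display P l η` — over `Cor22.logQAvoid P {2,l}` ("`log(q)`" of
  (P5)), `Cor22.dmod P` (`d_mod = [ℚ(j(λ)):ℚ]`), `P.logDiff`, `Cor22.logCondAvoid P {2,l}` — and the whole
  sentence as the HYPOTHESIS `Cor22.Thm110Legendre`, from which `Cor22.PartII`, hence the route's crux
  `ThetaPartII`, follows (S-d2's assembly).
* The c312 crew typed Theorem 1.10's INPUT: the VERBATIM statement of [IUTchIII] Cor. 3.12 (abc-iut-c312-7's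
  `Cor312.Setting.Statement`) for the situation `P` OF a collection of initial Θ-data `D` ([IUTchI] Def. 3.1,
  abc-iut-L5-t2's `InitialThetaData`) through the provenance link `Cor312Prov.IsSettingOf D P`, and campaign S's
  Theorem 1.10 itself (abc-iut-S3's `theorem110`, PROVED modulo the log-volume/different inputs `ProofData`) as the
  edge `Cor312Prov.theorem110_of_statement` (`Cor312ProvenanceS.lean`): `… → P.Statement → Display` for the
  numerics `numericsOf D P J` — whose `log(q)` is `Cor312Prov.logq D` (the normalized degree of the `q`-parameter
  divisor OF THE DATUM, [IUTchIV] p. 23) and whose `d_mod` is `[F_mod : ℚ]` of the datum's curve.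

THIS FILE identifies the two sets of numbers when the datum's curve IS the Legendre curve of the point — i.e. for
`D : InitialThetaData Q.F K Fbar (⟨0, -(1 + Q.x), 0, Q.x, 0⟩ : WeierstrassCurve Q.F) l Pb`, `Q = (F, λ)` a point of the `λ`-line presented over the
number field `F` of the datum (`NFPoint.legendreCurve Q = ⟨0, −(1+λ), 0, λ, 0⟩`, abc-iut-S4's `GenEllRemarks44.lean`;
for `Q = Cor22.extend P F` this is S-d2's `Cor22.thetaCurve P F` definitionally) — all PROVED:
* `j_legendreCurve`: `j(E_F) = j(λ)` (S5/S-d2's `Cor22.j_legendre`); `dmod_legendreCurve`: `[F_mod:ℚ] = Cor22.dmod Q`;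
* `qArithDivisor_apply`, **`qArithDivisor_legendre_eq_qDivisor`**, **`logq_legendre_eq_logQAvoid`**: under the (P5)
  CHOICE of `𝕍^bad_mod`, read at the level of `F` —
  `hV : v ∈ 𝕍(F)^bad ↔ (v ∤ 2 ∧ v ∤ l) ∧ E_F has multiplicative reduction at v` —
  the datum's `𝔮`-divisor IS the point's `q`-parameter divisor away from `{2, l}`, so `Cor312Prov.logq D =
  Cor22.logQAvoid Q {2, l}` (Tate: `ord_v(Δ_min) = −ord_v(j) = h_v` at a multiplicative place — S5/S-d2's
  `Cor22.localHeight_eq_ordMinimalDiscriminant_legendre`; semistability of `E_F` ([IUTchI] Def. 3.1 (b)) and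
  "good reduction ⟹ `|j|_v ≤ 1`" (`valuation_j_le_one_of_hasGoodReduction_localMinimalModel`) off `𝕍(F)^bad`);
* `logq_legendre_eq_logQAvoid_of_algebraMap`, `dmod_legendreCurve_of_algebraMap`: the same numbers read on the
  point presented over any SMALLER field `F_tpd ⊆ F` (e.g. its minimal field `ℚ(λ)`), by the independence of the
  presenting field (`Cor22.logQAvoid_of_algebraMap`, `Cor22.dmod_of_algebraMap`, [IUTchIV] p. 23 "independent of
  the choice of `F□`", `Corollary22QParamBaseChange.lean`);
* **`display_legendre`** / **`display_legendre_of_algebraMap`** — THE MEETING EDGE: for such `D`, a Cor. 3.12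
  setting `P` with `IsSettingOf D P`, [IUTchIV]-side inputs `J` whose `log(𝔡^{F_tpd})`, `log(𝔣^{F_tpd})` are the
  point's `logDiff`, `logCondAvoid _ {2,l}`, Thm. 1.10's proof data, `η_prm`, and `l ≠ 5`:
  `P.Statement → Cor22.Display (the point) l η_prm` — the display INSIDE S-d2's `Cor22.Thm110Legendre`, with
  `e*_mod ≤ d*_mod` applied as on p. 46 l. 1.
What remains between this edge and `Cor22.Thm110Legendre` is exactly the named opaque inputs, each owned
elsewhere: the EXISTENCE of `D` for `(λ, l)` with the (P5) choice ((P7), p. 46 — definition request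
defn-IsThetaAdmissible / layer L5), of the log-theta-lattice setting `P` with `IsSettingOf D P` (campaign M / c312),
`P.Statement` itself (the crux — disputed), and `ProofData` ([IUTchIV] Steps (ii)–(vii), Props. 1.3/1.8 — campaign S).
Nothing is asserted about any elliptic curve. [claim: Mochizuki2012, status: disputed] for every quotation.
-/

noncomputable section

namespace Summit.ABC.IUTFork.Cor312Prov

open Literature.IUT.HodgeTheaters Literature.IUT.LogVolume NumberField IsDedekindDomain
open Literature.NumberTheory.DiophantineGeometry.GenEll
open scoped Classical

universe u v w

/-! ## 1. The coefficients of the datum's `𝔮`-divisor (any initial Θ-data) -/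

section General

variable {F : Type u} {K : Type v} {Fbar : Type w} [Field F] [NumberField F] [Field K] [NumberField K]
  [Algebra F K] [Field Fbar] [Algebra F Fbar] [Algebra K Fbar] {E : WeierstrassCurve F} [E.IsElliptic]
  {l : ℕ} {Pb : BadPlacePredicates K}

/-- Coefficients of the `q`-parameter arithmetic divisor `𝔮^F_{ADiv} = Σ_{v ∈ 𝕍(F)^bad} ord_v(q_v)·[v]` of the datum
([IUTchIV] p. 23; `Cor312Prov.qArithDivisor`, indexed by Mathlib's finite places `FinitePlace F ≃ 𝕍(F)^non`): at a
finite place `w`, `ord_w(q_w)` (L5-t2's `qParamOrd = ord_w(Δ_min)`) if `w ∈ 𝕍(F)^bad`, else `0`. PROVED.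
[claim: Mochizuki2012, status: disputed] -/
theorem qArithDivisor_apply (D : InitialThetaData F K Fbar E l Pb) (hfin : D.VFbad.Finite)
    (w : HeightOneSpectrum (𝓞 F)) :
    qArithDivisor D hfin w = if FinitePlace.mk w ∈ D.VFbad then (qParamOrd E w : ℝ) else 0 := by
  unfold qArithDivisor
  rw [Finset.sum_apply']
  simp only [Finsupp.single_apply]
  by_cases hw : FinitePlace.mk w ∈ D.VFbad
  · rw [if_pos hw, Finset.sum_eq_single_of_mem (FinitePlace.mk w) (hfin.mem_toFinset.mpr hw)]
    · rw [if_pos (FinitePlace.maximalIdeal_mk w), FinitePlace.maximalIdeal_mk]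
    · intro v _ hne
      rw [if_neg]
      intro heq
      apply hne
      rw [← FinitePlace.mk_maximalIdeal v, heq]
  · rw [if_neg hw]
    refine Finset.sum_eq_zero fun v hv => ?_
    rw [if_neg]
    intro heq
    apply hw
    rw [← heq, FinitePlace.mk_maximalIdeal]
    exact hfin.mem_toFinset.mp hv

end General

/-! ## 2. The datum over the Legendre curve of a point of the `λ`-line -/

variable {Q : NFPoint} {K Fbar : Type} [Field K] [NumberField K] [Algebra Q.F K] [Field Fbar]
  [Algebra Q.F Fbar] [Algebra K Fbar] {l : ℕ} {Pb : BadPlacePredicates K}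

/-- **`j(E_F) = j(λ)`**: the `j`-invariant of the Legendre curve `y² = x(x−1)(x−λ)` of the point `Q = (F, λ)` ([IUTchIV]
Cor. 2.2 (ii) p. 42 "a model `E_{F_tpd}` … determined by the Legendre form") is `Cor22.jInv λ = 2⁸(λ²−λ+1)³/(λ²(λ−1)²)`
(p. 41 "the natural classifying morphism `U_X → (M_ell)_ℚ`") — abc-iut-S5/S-d2's `Cor22.j_legendre`, read on
S4's `NFPoint.legendreCurve`. PROVED. [claim: Mochizuki2012, status: disputed] -/
theorem j_legendreCurve (hQ : Q.InU) [hE : (⟨0, -(1 + Q.x), 0, Q.x, 0⟩ : WeierstrassCurve Q.F).IsElliptic] : (⟨0, -(1 + Q.x), 0, Q.x, 0⟩ : WeierstrassCurve Q.F).j = Cor22.jInv Q.x :=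
  Cor22.j_legendre Q hQ

/-- **`d_mod` of the datum is `d_mod` of the point**: `[F_mod : ℚ]` for `F_mod = ℚ(j(E_F))` (L5-t2's `fieldOfModuli`,
[IUTchI] Def. 3.1 (b); `Cor312Prov.dmod`) equals S-d2's `Cor22.dmod Q = [ℚ(j(λ)) : ℚ]` ([IUTchIV] Thm. 1.10 p. 22
"`d_mod := [F_mod : ℚ]`"). PROVED (`j(E_F) = j(λ)`). [claim: Mochizuki2012, status: disputed] -/
theorem dmod_legendreCurve (hQ : Q.InU) [hE : (⟨0, -(1 + Q.x), 0, Q.x, 0⟩ : WeierstrassCurve Q.F).IsElliptic] :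
    dmod (⟨0, -(1 + Q.x), 0, Q.x, 0⟩ : WeierstrassCurve Q.F) = Cor22.dmod Q := by
  unfold dmod Cor22.dmod fieldOfModuli
  rw [j_legendreCurve hQ]

/-- Off the poles of `j(λ)` the local height `h_w = max(0, −ord_w j(λ))` vanishes. PROVED.
[claim: Mochizuki2012, status: disputed] -/
theorem localHeight_eq_zero_of_not_mem_badPlaces {w : HeightOneSpectrum (𝓞 Q.F)} (hw : w ∉ Cor22.badPlaces Q) :
    Cor22.localHeight Q w = 0 := by
  rw [Cor22.mem_badPlaces_iff_ord_neg] at hw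
  unfold Cor22.localHeight
  rw [Int.toNat_eq_zero.mpr (by omega)]
  simp

/-- **The datum's `𝔮`-divisor IS the point's `q`-parameter divisor away from `{2, l}`** under the (P5) choice of
`𝕍^bad_mod` ([IUTchIV] Cor. 2.2 (ii), proof, p. 46: "(P5) `𝕍^bad_mod :=` the nonarchimedean valuations … that do not
divide `2l` and at which `E_F` has bad multiplicative reduction"), read at the level of `F`
(`hV : v ∈ 𝕍(F)^bad ↔ (v ∤ 2 ∧ v ∤ l) ∧ E_F multiplicative at v`): for an initial Θ-datum `D` over the Legendre curve
`E_F` of `Q = (F, λ)`, `𝔮^F_{ADiv}(D) = Σ_{v bad, v ∤ 2l} h_v·[v] = Cor22.qDivisor Q {2,l}`. PROVED: at a multiplicative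
`v`, `ord_v(q_v) := ord_v(Δ_min) = −ord_v(j(λ)) = h_v` (Tate; S5/S-d2's `Cor22.localHeight_eq_ordMinimalDiscriminant_legendre`,
Silverman AEC VII.5.1 (b)); at a place `v ∤ 2l` that is NOT multiplicative, `E_F` — semistable by [IUTchI] Def. 3.1 (b)
(`D.isSemistable`) — has good reduction, so `|j|_v ≤ 1` (AEC VII.5.1 (a), the tree's
`valuation_j_le_one_of_hasGoodReduction_localMinimalModel`) and `h_v = 0`. [claim: Mochizuki2012, status: disputed] -/
theorem qArithDivisor_legendre_eq_qDivisor (hQ : Q.InU) [hE : (⟨0, -(1 + Q.x), 0, Q.x, 0⟩ : WeierstrassCurve Q.F).IsElliptic]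
    (D : InitialThetaData Q.F K Fbar (⟨0, -(1 + Q.x), 0, Q.x, 0⟩ : WeierstrassCurve Q.F) l Pb)
    (hV : ∀ v : FinitePlace Q.F, v ∈ D.VFbad ↔
      (∀ p ∈ ({2, l} : Finset ℕ), ((p : ℕ) : 𝓞 Q.F) ∉ v.maximalIdeal.asIdeal) ∧
        (⟨0, -(1 + Q.x), 0, Q.x, 0⟩ : WeierstrassCurve Q.F).HasMultiplicativeReductionAt v.maximalIdeal) :
    qArithDivisor D (vFbad_finite D) = Cor22.qDivisor Q {2, l} := by
  ext w
  rw [qArithDivisor_apply, Cor22.qDivisor_apply]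
  have hVw := hV (FinitePlace.mk w)
  rw [FinitePlace.maximalIdeal_mk] at hVw
  by_cases hw : FinitePlace.mk w ∈ D.VFbad
  · -- a bad place of the datum: multiplicative, `ord_w(Δ_min) = h_w > 0`
    obtain ⟨hS, hmult⟩ := hVw.mp hw
    have hlh : Cor22.localHeight Q w = ((⟨0, -(1 + Q.x), 0, Q.x, 0⟩ : WeierstrassCurve Q.F).ordMinimalDiscriminant w : ℝ) :=
      Cor22.localHeight_eq_ordMinimalDiscriminant_legendre hQ hmult
    have hbad : w ∈ Cor22.badPlaces Q := by
      by_contra hnot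
      have h0 := localHeight_eq_zero_of_not_mem_badPlaces (Q := Q) hnot
      rw [hlh] at h0
      exact WeierstrassCurve.ordMinimalDiscriminant_ne_zero_of_hasMultiplicativeReductionAt w _ hmult
        (by exact_mod_cast h0)
    rw [if_pos hw, if_pos ⟨hbad, hS⟩, hlh]
    rfl
  · rw [if_neg hw]
    by_cases hS : ∀ p ∈ ({2, l} : Finset ℕ), ((p : ℕ) : 𝓞 Q.F) ∉ w.asIdeal
    · -- `w ∤ 2l` but not in `𝕍(F)^bad`: not multiplicative, hence good (semistable), hence `h_w = 0`
      have hnm : ¬ (⟨0, -(1 + Q.x), 0, Q.x, 0⟩ : WeierstrassCurve Q.F).HasMultiplicativeReductionAt w := fun hm => hw (hVw.mpr ⟨hS, hm⟩)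
      have hgood : (⟨0, -(1 + Q.x), 0, Q.x, 0⟩ : WeierstrassCurve Q.F).HasGoodReductionAt w := (D.isSemistable w).resolve_right hnm
      have hj : w.valuation Q.F (⟨0, -(1 + Q.x), 0, Q.x, 0⟩ : WeierstrassCurve Q.F).j ≤ 1 :=
        valuation_j_le_one_of_hasGoodReduction_localMinimalModel w (⟨0, -(1 + Q.x), 0, Q.x, 0⟩ : WeierstrassCurve Q.F) hgood
      have hnot : w ∉ Cor22.badPlaces Q := by
        rw [Cor22.badPlaces, Set.Finite.mem_toFinset]
        change ¬ (1 < w.valuation Q.F (Cor22.jInv Q.x))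
        rw [← j_legendreCurve hQ]
        exact not_lt.mpr hj
      rw [if_neg (fun h => hnot h.1)]
    · rw [if_neg (fun h => hS h.2)]

/-- **`log(q)` of the datum `=` `log(q^{∤{2,l}}(λ))` of the point** ([IUTchIV] p. 46 l. 1: Theorem 1.10's `log(q)` for
the Θ-data of (P5) is the `q`-parameter degree of `E_F` away from `2l`; S-d2's modelling decision "`log(q)` of
Theorem 1.10 for the initial Θ-data built in the proof … is `logQAvoid P {2, l}`" — here a THEOREM about the two real
definitions): under the (P5) choice `hV`, `Cor312Prov.logq D = Cor22.logQAvoid Q {2, l}`. PROVED.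
[claim: Mochizuki2012, status: disputed] -/
theorem logq_legendre_eq_logQAvoid (hQ : Q.InU) [hE : (⟨0, -(1 + Q.x), 0, Q.x, 0⟩ : WeierstrassCurve Q.F).IsElliptic]
    (D : InitialThetaData Q.F K Fbar (⟨0, -(1 + Q.x), 0, Q.x, 0⟩ : WeierstrassCurve Q.F) l Pb)
    (hV : ∀ v : FinitePlace Q.F, v ∈ D.VFbad ↔
      (∀ p ∈ ({2, l} : Finset ℕ), ((p : ℕ) : 𝓞 Q.F) ∉ v.maximalIdeal.asIdeal) ∧
        (⟨0, -(1 + Q.x), 0, Q.x, 0⟩ : WeierstrassCurve Q.F).HasMultiplicativeReductionAt v.maximalIdeal) :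
    logq D = Cor22.logQAvoid Q {2, l} := by
  rw [logq_eq_ndeg_qArithDivisor, qArithDivisor_legendre_eq_qDivisor hQ D hV]
  rfl

/-! ## 3. The same numbers read on the point presented over a smaller field `F_tpd ⊆ F` -/

section SmallerField

variable {P : NFPoint} [Algebra P.F Q.F]

/-- `log(q)` of the datum over `F` equals `log(q^{∤{2,l}}(λ))` of the point presented over any subfield `F_tpd ⊆ F`
over which `λ` is defined (`hx : λ_Q = λ_P` in `F`; e.g. `F_tpd = ℚ(λ)`, [IUTchIV] p. 42) — [IUTchIV] p. 23 "the
various `log(q_{(−)})`'s are independent of the choice of `F□`" (`Cor22.logQAvoid_of_algebraMap`). PROVED.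
[claim: Mochizuki2012, status: disputed] -/
theorem logq_legendre_eq_logQAvoid_of_algebraMap (hx : Q.x = algebraMap P.F Q.F P.x) (hQ : Q.InU)
    [hE : (⟨0, -(1 + Q.x), 0, Q.x, 0⟩ : WeierstrassCurve Q.F).IsElliptic] (D : InitialThetaData Q.F K Fbar (⟨0, -(1 + Q.x), 0, Q.x, 0⟩ : WeierstrassCurve Q.F) l Pb)
    (hV : ∀ v : FinitePlace Q.F, v ∈ D.VFbad ↔
      (∀ p ∈ ({2, l} : Finset ℕ), ((p : ℕ) : 𝓞 Q.F) ∉ v.maximalIdeal.asIdeal) ∧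
        (⟨0, -(1 + Q.x), 0, Q.x, 0⟩ : WeierstrassCurve Q.F).HasMultiplicativeReductionAt v.maximalIdeal) :
    logq D = Cor22.logQAvoid P {2, l} := by
  rw [logq_legendre_eq_logQAvoid hQ D hV, Cor22.logQAvoid_of_algebraMap hx]

/-- `d_mod` of the datum over `F` equals `Cor22.dmod` of the point presented over any subfield `F_tpd ⊆ F` over which
`λ` is defined (`Cor22.dmod_of_algebraMap`). PROVED. [claim: Mochizuki2012, status: disputed] -/
theorem dmod_legendreCurve_of_algebraMap (hx : Q.x = algebraMap P.F Q.F P.x) (hQ : Q.InU)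
    [hE : (⟨0, -(1 + Q.x), 0, Q.x, 0⟩ : WeierstrassCurve Q.F).IsElliptic] : dmod (⟨0, -(1 + Q.x), 0, Q.x, 0⟩ : WeierstrassCurve Q.F) = Cor22.dmod P := by
  rw [dmod_legendreCurve hQ, Cor22.dmod_of_algebraMap hx]

end SmallerField

/-! ## 4. THE MEETING EDGE: Cor. 3.12 for the datum of the point ⟹ the `λ`-line display of Thm. 1.10 -/

/-- **[IUTchIII] Cor. 3.12 (verbatim, for the Θ-data of a point of the `λ`-line) ⟹ [IUTchIV] Thm. 1.10's display FOR
THAT POINT.** Let `Q = (F, λ)` be a point of the `λ`-line (`λ ≠ 0, 1`), `D` a collection of initial Θ-data ([IUTchI]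
Def. 3.1) with "`F`" `= F`, "`X_F`" the once-punctured Legendre curve of `λ`, "`l`" `= l`, and "`𝕍^bad_mod`" the (P5)
choice ([IUTchIV] p. 46: the places not dividing `2l` of bad multiplicative reduction — `hV`); let `P` be a Cor. 3.12
setting that IS the situation of `D` (`IsSettingOf D P`), `J` the [IUTchIV]-side numbers of Thm. 1.10 for `D` with
`log(𝔡^{F_tpd}) := log-diff` of the point and `log(𝔣^{F_tpd}) := Cor22.logCondAvoid Q {2,l}` (p. 43: "`log-diff_X(x_E) =
log(𝔡^{F_tpd})`"; p. 23: `𝔣` = the reduced divisor of `Supp(𝔮)`), `PD` Thm. 1.10's proof data (Steps (ii)–(vii)), `η_prm`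
as in Prop. 1.6, and `l ≠ 5` (p. 22). THEN the verbatim statement of Cor. 3.12 for `P` implies S-d2's
`Cor22.Display Q l η_prm`: `(1/6)·log(q^{∤{2,l}}(λ)) ≤ (1 + 20·d_mod/l)·(log-diff + log(𝔣)) + 20·(d*_mod·l + η_prm)` — the
display of p. 46 l. 1 (with `e*_mod ≤ d*_mod` applied as printed there). PROVED: S3's `theorem110` through
`numericsOf_cor312_iff`, then `logq_legendre_eq_logQAvoid`, `dmod_legendreCurve`, `e_mod ≤ d_mod`. The display follows
FROM `P.Statement`, which nothing in the tree proves. [claim: Mochizuki2012, status: disputed] -/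
theorem display_legendre (hQ : Q.InU) [hE : (⟨0, -(1 + Q.x), 0, Q.x, 0⟩ : WeierstrassCurve Q.F).IsElliptic]
    (D : InitialThetaData Q.F K Fbar (⟨0, -(1 + Q.x), 0, Q.x, 0⟩ : WeierstrassCurve Q.F) l Pb)
    (hV : ∀ v : FinitePlace Q.F, v ∈ D.VFbad ↔
      (∀ p ∈ ({2, l} : Finset ℕ), ((p : ℕ) : 𝓞 Q.F) ∉ v.maximalIdeal.asIdeal) ∧
        (⟨0, -(1 + Q.x), 0, Q.x, 0⟩ : WeierstrassCurve Q.F).HasMultiplicativeReductionAt v.maximalIdeal)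
    {T : Thm311.ThetaIndex} {S : Thm311.Situation T} {P : Cor312.Setting S} (h : IsSettingOf D P)
    (J : NumericsInputs D) (hJd : J.logDiffTpd = Q.logDiff) (hJc : J.logCondTpd = Cor22.logCondAvoid Q {2, l})
    (PD : (numericsOf D P J).ProofData) (hη : IsEtaPrm J.etaPrm) (h5 : l ≠ 5) (hstat : P.Statement) :
    Cor22.Display Q l J.etaPrm := by
  have hd : (numericsOf D P J).Display :=
    (Thm110Numerics.theorem110 PD hη h5 ((numericsOf_cor312_iff P J h).mpr hstat)).2.2.1
  have hd' : 1 / 6 * logq D ≤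
      (1 + 20 * (dmod (⟨0, -(1 + Q.x), 0, Q.x, 0⟩ : WeierstrassCurve Q.F) : ℝ) / l) * (J.logDiffTpd + J.logCondTpd)
        + 20 * (((2 ^ 12 * 3 ^ 3 * 5 * J.emod : ℕ) : ℝ) * l + J.etaPrm) := hd
  rw [logq_legendre_eq_logQAvoid hQ D hV, dmod_legendreCurve hQ, hJd, hJc] at hd'
  unfold Cor22.Display
  -- `e*_mod·l ≤ d*_mod·l` (p. 46 l. 1), from `e_mod ≤ d_mod` (p. 22) and `d_mod` of the datum `=` `d_mod` of the point
  have hem : ((2 ^ 12 * 3 ^ 3 * 5 * J.emod : ℕ) : ℝ) * l ≤ 2 ^ 12 * 3 ^ 3 * 5 * (Cor22.dmod Q : ℝ) * l := by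
    have h1 : (J.emod : ℝ) ≤ (Cor22.dmod Q : ℝ) := by
      rw [← dmod_legendreCurve hQ]
      exact_mod_cast J.emod_le_dmod
    have h2 : ((2 ^ 12 * 3 ^ 3 * 5 * J.emod : ℕ) : ℝ) ≤ 2 ^ 12 * 3 ^ 3 * 5 * (Cor22.dmod Q : ℝ) := by
      push_cast
      linarith
    exact mul_le_mul_of_nonneg_right h2 (Nat.cast_nonneg l)
  refine hd'.trans ?_
  gcongr

/-- The same edge with "`l ≠ 5`" DISCHARGED from "the `(3·5)`-torsion points of `E_F` are defined over `F`" ([IUTchIV]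
Thm. 1.10 p. 22, via `Cor312ProvenanceL.l_ne_five_of_torsion15_fixed`). PROVED. [claim: Mochizuki2012, status: disputed] -/
theorem display_legendre_of_torsion15 (hQ : Q.InU) [hE : (⟨0, -(1 + Q.x), 0, Q.x, 0⟩ : WeierstrassCurve Q.F).IsElliptic]
    (D : InitialThetaData Q.F K Fbar (⟨0, -(1 + Q.x), 0, Q.x, 0⟩ : WeierstrassCurve Q.F) l Pb)
    (hV : ∀ v : FinitePlace Q.F, v ∈ D.VFbad ↔
      (∀ p ∈ ({2, l} : Finset ℕ), ((p : ℕ) : 𝓞 Q.F) ∉ v.maximalIdeal.asIdeal) ∧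
        (⟨0, -(1 + Q.x), 0, Q.x, 0⟩ : WeierstrassCurve Q.F).HasMultiplicativeReductionAt v.maximalIdeal)
    {T : Thm311.ThetaIndex} {S : Thm311.Situation T} {P : Cor312.Setting S} (h : IsSettingOf D P)
    (J : NumericsInputs D) (hJd : J.logDiffTpd = Q.logDiff) (hJc : J.logCondTpd = Cor22.logCondAvoid Q {2, l})
    (PD : (numericsOf D P J).ProofData) (hη : IsEtaPrm J.etaPrm) (h15 : TorsionFixed (⟨0, -(1 + Q.x), 0, Q.x, 0⟩ : WeierstrassCurve Q.F) Fbar 15)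
    (hstat : P.Statement) : Cor22.Display Q l J.etaPrm :=
  display_legendre hQ D hV h J hJd hJc PD hη (l_ne_five_of_torsion15_fixed D h15) hstat

/-- **The edge read on the point presented over a smaller field** `F_tpd ⊆ F` (`P = (F_tpd, λ)`, `Q = (F, λ)` the
same `λ`; [IUTchIV] Cor. 2.2 (ii): `x_E ∈ U_X(F_tpd)`, `F = F_tpd(√−1, E_{F_tpd}[3·5])`, and (C1), (C2) "concern only
invariants of the point `x_E ∈ U_X(F_tpd)`"): with `J`'s `log(𝔡^{F_tpd})`, `log(𝔣^{F_tpd})` those of `P`, Cor. 3.12 for the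
datum over `F` gives `Cor22.Display P l η_prm` — exactly the conclusion of S-d2's `Cor22.Thm110Legendre` at
`(η_prm, P, l)`. PROVED (`display_legendre` + independence of the presenting field for `log(q)` and `d_mod`).
[claim: Mochizuki2012, status: disputed] -/
theorem display_legendre_of_algebraMap {P₀ : NFPoint} [Algebra P₀.F Q.F] (hx : Q.x = algebraMap P₀.F Q.F P₀.x)
    (hQ : Q.InU) [hE : (⟨0, -(1 + Q.x), 0, Q.x, 0⟩ : WeierstrassCurve Q.F).IsElliptic]
    (D : InitialThetaData Q.F K Fbar (⟨0, -(1 + Q.x), 0, Q.x, 0⟩ : WeierstrassCurve Q.F) l Pb)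
    (hV : ∀ v : FinitePlace Q.F, v ∈ D.VFbad ↔
      (∀ p ∈ ({2, l} : Finset ℕ), ((p : ℕ) : 𝓞 Q.F) ∉ v.maximalIdeal.asIdeal) ∧
        (⟨0, -(1 + Q.x), 0, Q.x, 0⟩ : WeierstrassCurve Q.F).HasMultiplicativeReductionAt v.maximalIdeal)
    {T : Thm311.ThetaIndex} {S : Thm311.Situation T} {P : Cor312.Setting S} (h : IsSettingOf D P)
    (J : NumericsInputs D) (hJd : J.logDiffTpd = P₀.logDiff) (hJc : J.logCondTpd = Cor22.logCondAvoid P₀ {2, l})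
    (PD : (numericsOf D P J).ProofData) (hη : IsEtaPrm J.etaPrm) (h5 : l ≠ 5) (hstat : P.Statement) :
    Cor22.Display P₀ l J.etaPrm := by
  have hd : (numericsOf D P J).Display :=
    (Thm110Numerics.theorem110 PD hη h5 ((numericsOf_cor312_iff P J h).mpr hstat)).2.2.1
  have hd' : 1 / 6 * logq D ≤
      (1 + 20 * (dmod (⟨0, -(1 + Q.x), 0, Q.x, 0⟩ : WeierstrassCurve Q.F) : ℝ) / l) * (J.logDiffTpd + J.logCondTpd)
        + 20 * (((2 ^ 12 * 3 ^ 3 * 5 * J.emod : ℕ) : ℝ) * l + J.etaPrm) := hd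
  rw [logq_legendre_eq_logQAvoid_of_algebraMap hx hQ D hV, dmod_legendreCurve_of_algebraMap hx hQ, hJd, hJc]
    at hd'
  unfold Cor22.Display
  have hem : ((2 ^ 12 * 3 ^ 3 * 5 * J.emod : ℕ) : ℝ) * l ≤ 2 ^ 12 * 3 ^ 3 * 5 * (Cor22.dmod P₀ : ℝ) * l := by
    have h1 : (J.emod : ℝ) ≤ (Cor22.dmod P₀ : ℝ) := by
      rw [← dmod_legendreCurve_of_algebraMap hx hQ]
      exact_mod_cast J.emod_le_dmod
    have h2 : ((2 ^ 12 * 3 ^ 3 * 5 * J.emod : ℕ) : ℝ) ≤ 2 ^ 12 * 3 ^ 3 * 5 * (Cor22.dmod P₀ : ℝ) := by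
      push_cast
      linarith
    exact mul_le_mul_of_nonneg_right h2 (Nat.cast_nonneg l)
  refine hd'.trans ?_
  gcongr

/-! ## 5. In S-d2's vocabulary: `F ⊇ F_tpd`, `E_F = Cor22.thetaCurve P F`, the point `Cor22.extend P F` -/

section ThetaCurve

variable {P₀ : NFPoint} {F : Type} [Field F] [NumberField F] [Algebra P₀.F F] {K' Fbar' : Type} [Field K']
  [NumberField K'] [Algebra F K'] [Field Fbar'] [Algebra F Fbar'] [Algebra K' Fbar'] {Pb' : BadPlacePredicates K'}

/-- `j(E_F) = j(λ)` in S-d2's vocabulary: `(Cor22.thetaCurve P F).j = j(λ)` viewed in `F` (abc-iut-S-d1's dictionary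
item T1; here from S5's `Cor22.j_legendre` at the extended point and `Cor22.jInv_map`). PROVED.
[claim: Mochizuki2012, status: disputed] -/
theorem j_thetaCurve (hU : P₀.InU) [hE : (Cor22.thetaCurve P₀ F).IsElliptic] :
    (Cor22.thetaCurve P₀ F).j = algebraMap P₀.F F (Cor22.jInv P₀.x) := by
  haveI : (⟨0, -(1 + (Cor22.extend P₀ F).x), 0, (Cor22.extend P₀ F).x, 0⟩ :
      WeierstrassCurve (Cor22.extend P₀ F).F).IsElliptic := hE
  have h1 := j_legendreCurve (Q := Cor22.extend P₀ F) (Cor22.extend_inU hU F)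
  rw [Cor22.jInv_map]
  exact h1

/-- `d_mod` of a datum over `Cor22.thetaCurve P F` is S-d2's `Cor22.dmod P` of the point over `F_tpd`. PROVED.
[claim: Mochizuki2012, status: disputed] -/
theorem dmod_thetaCurve (hU : P₀.InU) [hE : (Cor22.thetaCurve P₀ F).IsElliptic] :
    dmod (Cor22.thetaCurve P₀ F) = Cor22.dmod P₀ :=
  letI : Algebra P₀.F (Cor22.extend P₀ F).F := ‹Algebra P₀.F F›
  haveI : (⟨0, -(1 + (Cor22.extend P₀ F).x), 0, (Cor22.extend P₀ F).x, 0⟩ :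
      WeierstrassCurve (Cor22.extend P₀ F).F).IsElliptic := hE
  dmod_legendreCurve_of_algebraMap (Q := Cor22.extend P₀ F) (P := P₀) rfl (Cor22.extend_inU hU F)

/-- **`log(q)` of a datum over `Cor22.thetaCurve P F` with the (P5) choice of `𝕍^bad_mod` IS `Cor22.logQAvoid P {2, l}`**
— S-d2's modelling decision ("`log(q)` of Theorem 1.10 for the initial Θ-data built in the proof … is
`logQAvoid P {2, l}`", `Corollary22Statement.lean`) as a THEOREM relating the two real definitions. PROVED.
[claim: Mochizuki2012, status: disputed] -/
theorem logq_thetaCurve_eq_logQAvoid (hU : P₀.InU) [hE : (Cor22.thetaCurve P₀ F).IsElliptic]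
    (D : InitialThetaData F K' Fbar' (Cor22.thetaCurve P₀ F) l Pb')
    (hV : ∀ v : FinitePlace F, v ∈ D.VFbad ↔
      (∀ p ∈ ({2, l} : Finset ℕ), ((p : ℕ) : 𝓞 F) ∉ v.maximalIdeal.asIdeal) ∧
        (Cor22.thetaCurve P₀ F).HasMultiplicativeReductionAt v.maximalIdeal) :
    logq D = Cor22.logQAvoid P₀ {2, l} :=
  letI : Algebra (Cor22.extend P₀ F).F K' := ‹Algebra F K'›
  letI : Algebra (Cor22.extend P₀ F).F Fbar' := ‹Algebra F Fbar'›
  letI : Algebra P₀.F (Cor22.extend P₀ F).F := ‹Algebra P₀.F F›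
  haveI : (⟨0, -(1 + (Cor22.extend P₀ F).x), 0, (Cor22.extend P₀ F).x, 0⟩ :
      WeierstrassCurve (Cor22.extend P₀ F).F).IsElliptic := hE
  logq_legendre_eq_logQAvoid_of_algebraMap (Q := Cor22.extend P₀ F) (P := P₀) rfl (Cor22.extend_inU hU F) D hV

/-- **The meeting edge in abc-iut-S-d2's vocabulary** (`Corollary22Legendre.lean`): for a point `P = (F_tpd, λ)` of the
`λ`-line, a number field `F ⊇ F_tpd` (e.g. a theta-field, `Cor22.IsThetaField P F`: "`F = F_tpd(√−1, E_{F_tpd}[3·5])`",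
[IUTchIV] p. 42), a collection of initial Θ-data `D` over `F` whose curve is `E_F = Cor22.thetaCurve P F` (the Legendre
curve of `λ` over `F`) with the (P5) choice of `𝕍^bad_mod` (`hV`), a Cor. 3.12 setting `P'` with `IsSettingOf D P'`,
inputs `J` with `log(𝔡^{F_tpd}) := P.logDiff`, `log(𝔣^{F_tpd}) := Cor22.logCondAvoid P {2,l}`, proof data, `η_prm`, `l ≠ 5`:
`P'.Statement → Cor22.Display P l η_prm` — the conclusion of `Cor22.Thm110Legendre` at `(η_prm, P, l)`. PROVED
(`display_legendre_of_algebraMap` at `Q := Cor22.extend P F`, for which `E_F` is the Legendre literal definitionally).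
[claim: Mochizuki2012, status: disputed] -/
theorem display_thetaCurve (hU : P₀.InU) [hE : (Cor22.thetaCurve P₀ F).IsElliptic]
    (D : InitialThetaData F K' Fbar' (Cor22.thetaCurve P₀ F) l Pb')
    (hV : ∀ v : FinitePlace F, v ∈ D.VFbad ↔
      (∀ p ∈ ({2, l} : Finset ℕ), ((p : ℕ) : 𝓞 F) ∉ v.maximalIdeal.asIdeal) ∧
        (Cor22.thetaCurve P₀ F).HasMultiplicativeReductionAt v.maximalIdeal)
    {T : Thm311.ThetaIndex} {S : Thm311.Situation T} {P : Cor312.Setting S} (h : IsSettingOf D P)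
    (J : NumericsInputs D) (hJd : J.logDiffTpd = P₀.logDiff) (hJc : J.logCondTpd = Cor22.logCondAvoid P₀ {2, l})
    (PD : (numericsOf D P J).ProofData) (hη : IsEtaPrm J.etaPrm) (h5 : l ≠ 5) (hstat : P.Statement) :
    Cor22.Display P₀ l J.etaPrm :=
  letI : Algebra (Cor22.extend P₀ F).F K' := ‹Algebra F K'›
  letI : Algebra (Cor22.extend P₀ F).F Fbar' := ‹Algebra F Fbar'›
  letI : Algebra P₀.F (Cor22.extend P₀ F).F := ‹Algebra P₀.F F›
  haveI : (⟨0, -(1 + (Cor22.extend P₀ F).x), 0, (Cor22.extend P₀ F).x, 0⟩ :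
      WeierstrassCurve (Cor22.extend P₀ F).F).IsElliptic := hE
  display_legendre_of_algebraMap (Q := Cor22.extend P₀ F) (P₀ := P₀) rfl (Cor22.extend_inU hU F) D hV h J hJd hJc
    PD hη h5 hstat

end ThetaCurve

end Summit.ABC.IUTFork.Cor312Prov

end
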